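import Summits.AtomisticToContinuum.Crystallization.Theses.DisclinationRation

/-!
# Birth skeleton — crux `DisclinationRation.FiveFoldRation`

Item `stmt-AtomisticToContinuum-15799` (crux K2, rank 3, route `DisclinationRation`
= route-AtomisticToContinuum-DisclinationRation, sub-problem `Crystallization`).

THE CRUX (pure metric geometry / defect topology, no potential). For every `δ > 0` and every
`δ`-separated, relatively dense `S ⊆ ℝ³` ALL of whose points are `1/20`-good in the ENLARGED alphabet
{fcc, hcp, decahedral-axis} (first shell `T_y = {z ∈ S : 0 < |z − y| < 13/10·d_y}`, rescaled by the
nearest-neighbour distance `d_y`, matched after a linear isometry `A` and a bijection to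
`fccKissingPattern`, `hcpKissingPattern` or the 12-point bicapped-pentagonal-prism pattern
`Deca = {±e₃} ∪ {(√3/2·cos(2πk/5), √3/2·sin(2πk/5), ±1/2)}`), the AXIS points (those that are not
`1/20`-{fcc,hcp}-good) have density zero uniformly on balls:
`∀ θ > 0 ∃ L₀ ∀ L ≥ L₀ ∀ c, #{axis points y, dist y c ≤ L} ≤ θ·L³`.

FIRST CUT = the route's own foreseen glued split (route header, TWO-LAYER PLAN:
`FiveFoldRation ⇐ FanStructure → CrossSectionGaussBonnet`), typed over existing declarations only
(the two shell predicates `GA` / `GF` of the route decl are inlined verbatim, so every interface is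
definitionally the crux's own), with the interface between the two halves made ROBUST UNDER THE
ELASTIC DISTORTIONS the `1/20` tolerance admits: the axes are handed over as COLUMNS — a family
`Γ : Set (ℤ → ℝ³)` of bi-infinite chains of axis points running pole-to-pole through the decahedral
shells — and NOT as lines parallel to one global direction (a single decahedral rod twisted by the
log-spiral map `x ↦ R(β·log|x|)·x`, strain `≤ β` everywhere, is still admissible but its one axis
turns through every direction of a plane: any "global axis direction" interface would be false while
the crux holds with `O(L)` axis points per ball).

* `stub_fanStructure` — COLUMN STRUCTURE (the "fan structure" half, local-to-global): for every
  admissible `S` there is `Γ : Set (ℤ → ℝ³)` such that (c1) every axis point lies on a chain of `Γ`;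
  (c2) every chain point is an axis point of `S` (chains never leave the axis set: axes are ENDLESS);
  (c3) chains run pole-to-pole: at `y = γ n` some decahedral matching `A, e` of the shell `T_y` has
  `γ (n+1)` within `d_y/20` of the north pole `y + d_y·A e₃` and `γ (n−1)` within `d_y/20` of the
  south pole (local straightness; the pole tolerance and the pattern's unit separation pin
  `γ (n±1)` to the two pole points of the shell). Mechanism: the POLE LEMMA — a pole `p` of an axis
  shell sees `y` and the shared pentagonal ring, i.e. SIX shell-mates pairwise at ≈ 60° from the
  direction `p → y`, while every vertex of the cuboctahedron / anticuboctahedron has exactly FOUR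
  contacts at 60° (next angle 90°) and only the POLES of `Deca` have five: so `p` is not
  {fcc,hcp}-good, is alphabet-good (hypothesis) hence decahedral with its axis through `y`; scale
  consistency `d_p ≥ 0.8·d_y` from the covering radius (≤ 46°) of the three patterns; then build
  `γ` by two recursions along the pole map (the pattern is symmetric under `e₃ ↦ −e₃`, so the frame
  can always be re-oriented). Why it might fail: the angular margins of the pole lemma at tolerance
  `1/20` with the OPEN `13/10` cutoff are a few degrees (scale ratio `d_p/d_y` is only pinned to
  `[0.8, 1.25]` a priori); a sub-tolerance ambiguity would let a column END inside good material.
  Size M–L (finite local classification, certifiable by interval arithmetic, + recursion).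
  Neither implies nor is implied by the crux cheaply: pure STRUCTURE, no counting.
* `stub_crossSectionGaussBonnet` — THE GAUSS–BONNET COUNT GIVEN THE COLUMNS, at the codimension-2
  rate: for every admissible `S` and every column family `Γ` with (c1)–(c3) there is `C`
  (depending on `S`) with `#{axis points, dist · c ≤ L} ≤ C·L²` for all `L ≥ 1`, all `c`.
  Mechanism (route rationale): twin fans of distinct columns cannot cross in good material
  (`(m₁m₂)² = rotation by 4·70.53° ≠ 2π`), so columns through one ball are locally parallel and a
  cross-section transverse to them carries a loop of length `O(L)` through ≤ 5 %-strained good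
  material with turning defect `≤ 2π + C'·L`; every enclosed column contributes the SAME-SIGN wedge
  deficit `2π − 5·arccos(1/3) = 0.12834` (negative-wedge axes have inadmissible shells): `O(1 + L)`
  columns per cross-section, each meeting the ball in `≤ 2L/δ + 1` points (chains are
  `δ`-separated and pole-to-pole): `O(L²)` (the rod-class Cohn–Vossen count of the sibling file
  `Cruxes/FiveFoldRationingR/Disproof.lean` §(b) is the translation-invariant case, with `O(1)`
  columns). Why it might fail: the strain term needs the holonomy of the good material along loops
  crossing twin sheets (mirrors: bookkeeping of the `Σ3` coset) to be controlled by the tolerance,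
  and slowly spiralling columns (log-drift of the orientation, as above) must still be met
  transversally by ONE cross-section per ball. Size L. STRONGER conclusion than the crux
  (quadratic, not `o(L³)`) under an EXTRA structural hypothesis: neither direction is cheap.

Assembly `FiveFoldRation_of : Sig.stub_fanStructure → Sig.stub_crossSectionGaussBonnet → FiveFoldRation`
(the two stub statements as NAMED propositions, verbatim; real proof, no `sorry`):
given admissible `δ, S` and `θ > 0`, stub 1 gives `Γ`, stub 2 gives `C`; with `L₀ := max 1 (C/θ)`
every `L ≥ L₀` has `C·L² ≤ θ·L·L² = θ·L³`. Concludes the route decl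
`DisclinationRation.FiveFoldRation` BY NAME; `FiveFoldRation_proof` is the hypothesis-free
instantiation with the two stubs (the registered target). Sorries: exactly the two stubs.

Disproof used: none on file for this crux (`ledger crux ls stmt-AtomisticToContinuum-15799`: no
workfiles at registration). Checked against the sibling crux's landed negatives
(`Theorems/FiveFoldRationingR/Negative/*`, `…_false_without_allSites`: ONE-SHELL-DEEP local
exclusion of five-fold bonds is false on the decahedral rod): neither stub excludes anything
locally — stub 1 only STRUCTURES the axis set (the rod's single column satisfies it), stub 2 counts
on balls of every radius — and the all-gapped decahedral rod satisfies both (one column, `O(L)`).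
-/

namespace Summit.AtomisticToContinuum.Crystallization.Cruxes.FiveFoldRation.Birth

/-- **Stub 1 — fan structure: the axis points of an everywhere-alphabet-good Delone set form
endless pole-to-pole columns.** For every `δ > 0` and every `δ`-separated, relatively dense
`S ⊆ ℝ³` all of whose points are `1/20`-good in the alphabet {fcc, hcp, decahedral-axis} there is a
family `Γ` of chains `ℤ → ℝ³` with: (c1) every axis point (not `1/20`-{fcc,hcp}-good) lies on a
chain of `Γ`; (c2) every point of every chain is an axis point of `S`; (c3) at each chain point
`y = γ n` some decahedral matching `A, e` of the rescaled shell has `γ (n+1)` at the north pole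
`A e₃` and `γ (n−1)` at the south pole `A (−e₃)`, within `1/20`. Shell predicates = the route decl's
`GA` / `GF`, inlined verbatim. -/
theorem stub_fanStructure : ∀ δ : ℝ, 0 < δ → ∀ S : Set (EuclideanSpace ℝ (Fin 3)), (∀ y ∈ S, ∀ z ∈ S, y ≠ z → δ ≤ dist y z) → (∃ R₁ : ℝ, ∀ p : EuclideanSpace ℝ (Fin 3), ∃ y ∈ S, dist y p ≤ R₁) → (∀ y ∈ S, (let d : ℝ := sInf ((fun z => dist z y) '' (S \ {y})); let T : Set (EuclideanSpace ℝ (Fin 3)) := {z : EuclideanSpace ℝ (Fin 3) | z ∈ S ∧ z ≠ y ∧ dist z y < 13 / 10 * d}; ∃ A : EuclideanSpace ℝ (Fin 3) →ₗᵢ[ℝ] EuclideanSpace ℝ (Fin 3), (∃ e : ↥T ≃ ↥Literature.Geometry.DiscreteGeometry.fccKissingPattern, ∀ t : ↥T, dist (d⁻¹ • ((t : EuclideanSpace ℝ (Fin 3)) - y)) (A ((e t : ↥Literature.Geometry.DiscreteGeometry.fccKissingPattern) : EuclideanSpace ℝ (Fin 3))) ≤ 1 / 20) ∨ (∃ e :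 ↥T ≃ ↥Literature.Geometry.DiscreteGeometry.hcpKissingPattern, ∀ t : ↥T, dist (d⁻¹ • ((t : EuclideanSpace ℝ (Fin 3)) - y)) (A ((e t : ↥Literature.Geometry.DiscreteGeometry.hcpKissingPattern) : EuclideanSpace ℝ (Fin 3))) ≤ 1 / 20) ∨ (∃ e : ↥T ≃ ↥{p : EuclideanSpace ℝ (Fin 3) | p = !₂[(0 : ℝ), 0, 1] ∨ p = !₂[(0 : ℝ), 0, -1] ∨ ∃ k : Fin 5, ∃ σ : ℝ, (σ = 1 / 2 ∨ σ = -(1 / 2)) ∧ p = !₂[Real.sqrt 3 / 2 * Real.cos (2 * Real.pi * (k : ℝ) / 5), Real.sqrt 3 / 2 * Real.sin (2 * Real.pi * (k : ℝ) / 5), σ]}, ∀ t : ↥T, dist (d⁻¹ • ((t : EuclideanSpace ℝ (Fin 3)) - y)) (A ((e t : ↥{p : EuclideanSpace ℝ (Fin 3) | p = !₂[(0 : ℝ), 0, 1] ∨ p = !₂[(0 : ℝ), 0, -1] ∨ ∃ k : Fin 5, ∃ σ : ℝ, (σ = 1 / 2 ∨ σ = -(1 / 2)) ∧ p = !₂[Real.sqrt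 3 / 2 * Real.cos (2 * Real.pi * (k : ℝ) / 5), Real.sqrt 3 / 2 * Real.sin (2 * Real.pi * (k : ℝ) / 5), σ]}) : EuclideanSpace ℝ (Fin 3))) ≤ 1 / 20))) → ∃ Γ : Set (ℤ → EuclideanSpace ℝ (Fin 3)), (∀ y ∈ S, ¬ (let d : ℝ := sInf ((fun z => dist z y) '' (S \ {y})); let T : Set (EuclideanSpace ℝ (Fin 3)) := {z : EuclideanSpace ℝ (Fin 3) | z ∈ S ∧ z ≠ y ∧ dist z y < 13 / 10 * d}; ∃ A : EuclideanSpace ℝ (Fin 3) →ₗᵢ[ℝ] EuclideanSpace ℝ (Fin 3), (∃ e : ↥T ≃ ↥Literature.Geometry.DiscreteGeometry.fccKissingPattern, ∀ t : ↥T, dist (d⁻¹ • ((t : EuclideanSpace ℝ (Fin 3)) - y)) (A ((e t : ↥Literature.Geometry.DiscreteGeometry.fccKissingPattern) : EuclideanSpace ℝ (Fin 3))) ≤ 1 / 20) ∨ (∃ e : ↥T ≃ ↥Literature.Geometry.DiscreteGeometry.hcpKissingPattern, ∀ t : ↥T, dist (d⁻¹ • ((t : EuclideanSpace ℝ (Fin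 3)) - y)) (A ((e t : ↥Literature.Geometry.DiscreteGeometry.hcpKissingPattern) : EuclideanSpace ℝ (Fin 3))) ≤ 1 / 20)) → ∃ γ ∈ Γ, ∃ n : ℤ, γ n = y) ∧ (∀ γ ∈ Γ, ∀ n : ℤ, γ n ∈ S ∧ ¬ (let y : EuclideanSpace ℝ (Fin 3) := γ n; let d : ℝ := sInf ((fun z => dist z y) '' (S \ {y})); let T : Set (EuclideanSpace ℝ (Fin 3)) := {z : EuclideanSpace ℝ (Fin 3) | z ∈ S ∧ z ≠ y ∧ dist z y < 13 / 10 * d}; ∃ A : EuclideanSpace ℝ (Fin 3) →ₗᵢ[ℝ] EuclideanSpace ℝ (Fin 3), (∃ e : ↥T ≃ ↥Literature.Geometry.DiscreteGeometry.fccKissingPattern, ∀ t : ↥T, dist (d⁻¹ • ((t : EuclideanSpace ℝ (Fin 3)) - y)) (A ((e t : ↥Literature.Geometry.DiscreteGeometry.fccKissingPattern) : EuclideanSpace ℝ (Fin 3))) ≤ 1 / 20) ∨ (∃ e : ↥T ≃ ↥Literature.Geometry.DiscreteGeometry.hcpKissingPattern, ∀ t : ↥T, dist (d⁻¹ • ((t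 : EuclideanSpace ℝ (Fin 3)) - y)) (A ((e t : ↥Literature.Geometry.DiscreteGeometry.hcpKissingPattern) : EuclideanSpace ℝ (Fin 3))) ≤ 1 / 20))) ∧ (∀ γ ∈ Γ, ∀ n : ℤ, (let y : EuclideanSpace ℝ (Fin 3) := γ n; let d : ℝ := sInf ((fun z => dist z y) '' (S \ {y})); let T : Set (EuclideanSpace ℝ (Fin 3)) := {z : EuclideanSpace ℝ (Fin 3) | z ∈ S ∧ z ≠ y ∧ dist z y < 13 / 10 * d}; ∃ A : EuclideanSpace ℝ (Fin 3) →ₗᵢ[ℝ] EuclideanSpace ℝ (Fin 3), (∃ e : ↥T ≃ ↥{p : EuclideanSpace ℝ (Fin 3) | p = !₂[(0 : ℝ), 0, 1] ∨ p = !₂[(0 : ℝ), 0, -1] ∨ ∃ k : Fin 5, ∃ σ : ℝ, (σ = 1 / 2 ∨ σ = -(1 / 2)) ∧ p = !₂[Real.sqrt 3 / 2 * Real.cos (2 * Real.pi * (k : ℝ) / 5), Real.sqrt 3 / 2 * Real.sin (2 * Real.pi * (k : ℝ) / 5), σ]}, ∀ t : ↥T, dist (d⁻¹ • ((t : EuclideanSpace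 ℝ (Fin 3)) - y)) (A ((e t : ↥{p : EuclideanSpace ℝ (Fin 3) | p = !₂[(0 : ℝ), 0, 1] ∨ p = !₂[(0 : ℝ), 0, -1] ∨ ∃ k : Fin 5, ∃ σ : ℝ, (σ = 1 / 2 ∨ σ = -(1 / 2)) ∧ p = !₂[Real.sqrt 3 / 2 * Real.cos (2 * Real.pi * (k : ℝ) / 5), Real.sqrt 3 / 2 * Real.sin (2 * Real.pi * (k : ℝ) / 5), σ]}) : EuclideanSpace ℝ (Fin 3))) ≤ 1 / 20) ∧ dist (d⁻¹ • (γ (n + 1) - y)) (A (!₂[(0 : ℝ), 0, 1])) ≤ 1 / 20 ∧ dist (d⁻¹ • (γ (n - 1) - y)) (A (!₂[(0 : ℝ), 0, -1])) ≤ 1 / 20)) := by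
  sorry

/-- **Stub 2 — cross-section Gauss–Bonnet count (given the columns, codimension-2 rate).** For
every `δ > 0`, every `δ`-separated, relatively dense, everywhere-alphabet-good `S ⊆ ℝ³` and every
column family `Γ` with (c1)–(c3) of stub 1 (taken as HYPOTHESES), there is a constant `C` such that
for every `L ≥ 1` and every centre `c` at most `C·L²` axis points `y` have `dist y c ≤ L`
(`O(1 + L)` same-sign wedge columns across a transverse cross-section by Gauss–Bonnet, times
`≤ 2L/δ + 1` points per column). -/
theorem stub_crossSectionGaussBonnet : ∀ δ : ℝ, 0 < δ → ∀ S : Set (EuclideanSpace ℝ (Fin 3)), (∀ y ∈ S, ∀ z ∈ S, y ≠ z → δ ≤ dist y z) → (∃ R₁ : ℝ, ∀ p : EuclideanSpace ℝ (Fin 3), ∃ y ∈ S, dist y p ≤ R₁) → (∀ y ∈ S, (let d : ℝ := sInf ((fun z => dist z y) '' (S \ {y})); let T : Set (EuclideanSpace ℝ (Fin 3)) := {z : EuclideanSpace ℝ (Fin 3) | z ∈ S ∧ z ≠ y ∧ dist z y < 13 / 10 * d}; ∃ A : EuclideanSpace ℝ (Fin 3) →ₗᵢ[ℝ] EuclideanSpace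 ℝ (Fin 3), (∃ e : ↥T ≃ ↥Literature.Geometry.DiscreteGeometry.fccKissingPattern, ∀ t : ↥T, dist (d⁻¹ • ((t : EuclideanSpace ℝ (Fin 3)) - y)) (A ((e t : ↥Literature.Geometry.DiscreteGeometry.fccKissingPattern) : EuclideanSpace ℝ (Fin 3))) ≤ 1 / 20) ∨ (∃ e : ↥T ≃ ↥Literature.Geometry.DiscreteGeometry.hcpKissingPattern, ∀ t : ↥T, dist (d⁻¹ • ((t : EuclideanSpace ℝ (Fin 3)) - y)) (A ((e t : ↥Literature.Geometry.DiscreteGeometry.hcpKissingPattern) : EuclideanSpace ℝ (Fin 3))) ≤ 1 / 20) ∨ (∃ e : ↥T ≃ ↥{p : EuclideanSpace ℝ (Fin 3) | p = !₂[(0 : ℝ), 0, 1] ∨ p = !₂[(0 : ℝ), 0, -1] ∨ ∃ k : Fin 5, ∃ σ : ℝ, (σ = 1 / 2 ∨ σ = -(1 / 2)) ∧ p = !₂[Real.sqrt 3 / 2 * Real.cos (2 * Real.pi * (k : ℝ) / 5), Real.sqrt 3 / 2 * Real.sin (2 * Real.pi * (k : ℝ) / 5), σ]}, ∀ t : ↥T,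 dist (d⁻¹ • ((t : EuclideanSpace ℝ (Fin 3)) - y)) (A ((e t : ↥{p : EuclideanSpace ℝ (Fin 3) | p = !₂[(0 : ℝ), 0, 1] ∨ p = !₂[(0 : ℝ), 0, -1] ∨ ∃ k : Fin 5, ∃ σ : ℝ, (σ = 1 / 2 ∨ σ = -(1 / 2)) ∧ p = !₂[Real.sqrt 3 / 2 * Real.cos (2 * Real.pi * (k : ℝ) / 5), Real.sqrt 3 / 2 * Real.sin (2 * Real.pi * (k : ℝ) / 5), σ]}) : EuclideanSpace ℝ (Fin 3))) ≤ 1 / 20))) → ∀ Γ : Set (ℤ → EuclideanSpace ℝ (Fin 3)), (∀ y ∈ S, ¬ (let d : ℝ := sInf ((fun z => dist z y) '' (S \ {y})); let T : Set (EuclideanSpace ℝ (Fin 3)) := {z : EuclideanSpace ℝ (Fin 3) | z ∈ S ∧ z ≠ y ∧ dist z y < 13 / 10 * d}; ∃ A : EuclideanSpace ℝ (Fin 3) →ₗᵢ[ℝ] EuclideanSpace ℝ (Fin 3), (∃ e : ↥T ≃ ↥Literature.Geometry.DiscreteGeometry.fccKissingPattern, ∀ t : ↥T, dist (d⁻¹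 • ((t : EuclideanSpace ℝ (Fin 3)) - y)) (A ((e t : ↥Literature.Geometry.DiscreteGeometry.fccKissingPattern) : EuclideanSpace ℝ (Fin 3))) ≤ 1 / 20) ∨ (∃ e : ↥T ≃ ↥Literature.Geometry.DiscreteGeometry.hcpKissingPattern, ∀ t : ↥T, dist (d⁻¹ • ((t : EuclideanSpace ℝ (Fin 3)) - y)) (A ((e t : ↥Literature.Geometry.DiscreteGeometry.hcpKissingPattern) : EuclideanSpace ℝ (Fin 3))) ≤ 1 / 20)) → ∃ γ ∈ Γ, ∃ n : ℤ, γ n = y) → (∀ γ ∈ Γ, ∀ n : ℤ, γ n ∈ S ∧ ¬ (let y : EuclideanSpace ℝ (Fin 3) := γ n; let d : ℝ := sInf ((fun z => dist z y) '' (S \ {y})); let T : Set (EuclideanSpace ℝ (Fin 3)) := {z : EuclideanSpace ℝ (Fin 3) | z ∈ S ∧ z ≠ y ∧ dist z y < 13 / 10 * d}; ∃ A : EuclideanSpace ℝ (Fin 3) →ₗᵢ[ℝ] EuclideanSpace ℝ (Fin 3), (∃ e : ↥T ≃ ↥Literature.Geometry.DiscreteGeometry.fccKissingPattern, ∀ t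 : ↥T, dist (d⁻¹ • ((t : EuclideanSpace ℝ (Fin 3)) - y)) (A ((e t : ↥Literature.Geometry.DiscreteGeometry.fccKissingPattern) : EuclideanSpace ℝ (Fin 3))) ≤ 1 / 20) ∨ (∃ e : ↥T ≃ ↥Literature.Geometry.DiscreteGeometry.hcpKissingPattern, ∀ t : ↥T, dist (d⁻¹ • ((t : EuclideanSpace ℝ (Fin 3)) - y)) (A ((e t : ↥Literature.Geometry.DiscreteGeometry.hcpKissingPattern) : EuclideanSpace ℝ (Fin 3))) ≤ 1 / 20))) → (∀ γ ∈ Γ, ∀ n : ℤ, (let y : EuclideanSpace ℝ (Fin 3) := γ n; let d : ℝ := sInf ((fun z => dist z y) '' (S \ {y})); let T : Set (EuclideanSpace ℝ (Fin 3)) := {z : EuclideanSpace ℝ (Fin 3) | z ∈ S ∧ z ≠ y ∧ dist z y < 13 / 10 * d}; ∃ A : EuclideanSpace ℝ (Fin 3) →ₗᵢ[ℝ] EuclideanSpace ℝ (Fin 3), (∃ e : ↥T ≃ ↥{p : EuclideanSpace ℝ (Fin 3) | p = !₂[(0 : ℝ), 0, 1] ∨ p = !₂[(0 : ℝ), 0,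 -1] ∨ ∃ k : Fin 5, ∃ σ : ℝ, (σ = 1 / 2 ∨ σ = -(1 / 2)) ∧ p = !₂[Real.sqrt 3 / 2 * Real.cos (2 * Real.pi * (k : ℝ) / 5), Real.sqrt 3 / 2 * Real.sin (2 * Real.pi * (k : ℝ) / 5), σ]}, ∀ t : ↥T, dist (d⁻¹ • ((t : EuclideanSpace ℝ (Fin 3)) - y)) (A ((e t : ↥{p : EuclideanSpace ℝ (Fin 3) | p = !₂[(0 : ℝ), 0, 1] ∨ p = !₂[(0 : ℝ), 0, -1] ∨ ∃ k : Fin 5, ∃ σ : ℝ, (σ = 1 / 2 ∨ σ = -(1 / 2)) ∧ p = !₂[Real.sqrt 3 / 2 * Real.cos (2 * Real.pi * (k : ℝ) / 5), Real.sqrt 3 / 2 * Real.sin (2 * Real.pi * (k : ℝ) / 5), σ]}) : EuclideanSpace ℝ (Fin 3))) ≤ 1 / 20) ∧ dist (d⁻¹ • (γ (n + 1) - y)) (A (!₂[(0 : ℝ), 0, 1])) ≤ 1 / 20 ∧ dist (d⁻¹ • (γ (n - 1) - y)) (A (!₂[(0 : ℝ), 0, -1])) ≤ 1 / 20)) → ∃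 C : ℝ, ∀ L : ℝ, 1 ≤ L → ∀ c : EuclideanSpace ℝ (Fin 3), (({y : EuclideanSpace ℝ (Fin 3) | y ∈ S ∧ dist y c ≤ L ∧ ¬ (let d : ℝ := sInf ((fun z => dist z y) '' (S \ {y})); let T : Set (EuclideanSpace ℝ (Fin 3)) := {z : EuclideanSpace ℝ (Fin 3) | z ∈ S ∧ z ≠ y ∧ dist z y < 13 / 10 * d}; ∃ A : EuclideanSpace ℝ (Fin 3) →ₗᵢ[ℝ] EuclideanSpace ℝ (Fin 3), (∃ e : ↥T ≃ ↥Literature.Geometry.DiscreteGeometry.fccKissingPattern, ∀ t : ↥T, dist (d⁻¹ • ((t : EuclideanSpace ℝ (Fin 3)) - y)) (A ((e t : ↥Literature.Geometry.DiscreteGeometry.fccKissingPattern) : EuclideanSpace ℝ (Fin 3))) ≤ 1 / 20) ∨ (∃ e : ↥T ≃ ↥Literature.Geometry.DiscreteGeometry.hcpKissingPattern, ∀ t : ↥T, dist (d⁻¹ • ((t : EuclideanSpace ℝ (Fin 3)) - y)) (A ((e t : ↥Literature.Geometry.DiscreteGeometry.hcpKissingPattern) : EuclideanSpace ℝ (Fin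 3))) ≤ 1 / 20))} : Set (EuclideanSpace ℝ (Fin 3))).ncard : ℝ) ≤ C * L ^ 2 := by
  sorry

/-! ## The stub statements as named propositions (verbatim the stub signatures)

Named carriers so that the composition below takes its hypotheses BY (stub) NAME, as the
skeleton audit requires; `stub_fanStructure : Sig.stub_fanStructure` holds by `Iff.rfl`-unfolding. -/

/-- Statement of `stub_fanStructure` (verbatim). -/
def Sig.stub_fanStructure : Prop :=
  ∀ δ : ℝ, 0 < δ → ∀ S : Set (EuclideanSpace ℝ (Fin 3)), (∀ y ∈ S, ∀ z ∈ S, y ≠ z → δ ≤ dist y z) → (∃ R₁ : ℝ, ∀ p : EuclideanSpace ℝ (Fin 3), ∃ y ∈ S, dist y p ≤ R₁) → (∀ y ∈ S, (let d : ℝ := sInf ((fun z => dist z y) '' (S \ {y})); let T : Set (EuclideanSpace ℝ (Fin 3)) := {z : EuclideanSpace ℝ (Fin 3) | z ∈ S ∧ z ≠ y ∧ dist z y < 13 / 10 * d}; ∃ A : EuclideanSpace ℝ (Fin 3) →ₗᵢ[ℝ] EuclideanSpace ℝ (Fin 3), (∃ e : ↥T ≃ ↥Literature.Geometry.DiscreteGeometry.fccKissingPattern,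 ∀ t : ↥T, dist (d⁻¹ • ((t : EuclideanSpace ℝ (Fin 3)) - y)) (A ((e t : ↥Literature.Geometry.DiscreteGeometry.fccKissingPattern) : EuclideanSpace ℝ (Fin 3))) ≤ 1 / 20) ∨ (∃ e : ↥T ≃ ↥Literature.Geometry.DiscreteGeometry.hcpKissingPattern, ∀ t : ↥T, dist (d⁻¹ • ((t : EuclideanSpace ℝ (Fin 3)) - y)) (A ((e t : ↥Literature.Geometry.DiscreteGeometry.hcpKissingPattern) : EuclideanSpace ℝ (Fin 3))) ≤ 1 / 20) ∨ (∃ e : ↥T ≃ ↥{p : EuclideanSpace ℝ (Fin 3) | p = !₂[(0 : ℝ), 0, 1] ∨ p = !₂[(0 : ℝ), 0, -1] ∨ ∃ k : Fin 5, ∃ σ : ℝ, (σ = 1 / 2 ∨ σ = -(1 / 2)) ∧ p = !₂[Real.sqrt 3 / 2 * Real.cos (2 * Real.pi * (k : ℝ) / 5), Real.sqrt 3 / 2 * Real.sin (2 * Real.pi * (k : ℝ) / 5), σ]}, ∀ t : ↥T, dist (d⁻¹ • ((t : EuclideanSpace ℝ (Fin 3)) - y)) (A ((e t : ↥{p : EuclideanSpace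 ℝ (Fin 3) | p = !₂[(0 : ℝ), 0, 1] ∨ p = !₂[(0 : ℝ), 0, -1] ∨ ∃ k : Fin 5, ∃ σ : ℝ, (σ = 1 / 2 ∨ σ = -(1 / 2)) ∧ p = !₂[Real.sqrt 3 / 2 * Real.cos (2 * Real.pi * (k : ℝ) / 5), Real.sqrt 3 / 2 * Real.sin (2 * Real.pi * (k : ℝ) / 5), σ]}) : EuclideanSpace ℝ (Fin 3))) ≤ 1 / 20))) → ∃ Γ : Set (ℤ → EuclideanSpace ℝ (Fin 3)), (∀ y ∈ S, ¬ (let d : ℝ := sInf ((fun z => dist z y) '' (S \ {y})); let T : Set (EuclideanSpace ℝ (Fin 3)) := {z : EuclideanSpace ℝ (Fin 3) | z ∈ S ∧ z ≠ y ∧ dist z y < 13 / 10 * d}; ∃ A : EuclideanSpace ℝ (Fin 3) →ₗᵢ[ℝ] EuclideanSpace ℝ (Fin 3), (∃ e : ↥T ≃ ↥Literature.Geometry.DiscreteGeometry.fccKissingPattern, ∀ t : ↥T, dist (d⁻¹ • ((t : EuclideanSpace ℝ (Fin 3)) - y)) (A ((e t : ↥Literature.Geometry.DiscreteGeometry.fccKissingPattern)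 : EuclideanSpace ℝ (Fin 3))) ≤ 1 / 20) ∨ (∃ e : ↥T ≃ ↥Literature.Geometry.DiscreteGeometry.hcpKissingPattern, ∀ t : ↥T, dist (d⁻¹ • ((t : EuclideanSpace ℝ (Fin 3)) - y)) (A ((e t : ↥Literature.Geometry.DiscreteGeometry.hcpKissingPattern) : EuclideanSpace ℝ (Fin 3))) ≤ 1 / 20)) → ∃ γ ∈ Γ, ∃ n : ℤ, γ n = y) ∧ (∀ γ ∈ Γ, ∀ n : ℤ, γ n ∈ S ∧ ¬ (let y : EuclideanSpace ℝ (Fin 3) := γ n; let d : ℝ := sInf ((fun z => dist z y) '' (S \ {y})); let T : Set (EuclideanSpace ℝ (Fin 3)) := {z : EuclideanSpace ℝ (Fin 3) | z ∈ S ∧ z ≠ y ∧ dist z y < 13 / 10 * d}; ∃ A : EuclideanSpace ℝ (Fin 3) →ₗᵢ[ℝ] EuclideanSpace ℝ (Fin 3), (∃ e : ↥T ≃ ↥Literature.Geometry.DiscreteGeometry.fccKissingPattern, ∀ t : ↥T, dist (d⁻¹ • ((t : EuclideanSpace ℝ (Fin 3)) - y)) (A ((e t : ↥Literature.Geometry.DiscreteGeometry.fccKissingPattern)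 : EuclideanSpace ℝ (Fin 3))) ≤ 1 / 20) ∨ (∃ e : ↥T ≃ ↥Literature.Geometry.DiscreteGeometry.hcpKissingPattern, ∀ t : ↥T, dist (d⁻¹ • ((t : EuclideanSpace ℝ (Fin 3)) - y)) (A ((e t : ↥Literature.Geometry.DiscreteGeometry.hcpKissingPattern) : EuclideanSpace ℝ (Fin 3))) ≤ 1 / 20))) ∧ (∀ γ ∈ Γ, ∀ n : ℤ, (let y : EuclideanSpace ℝ (Fin 3) := γ n; let d : ℝ := sInf ((fun z => dist z y) '' (S \ {y})); let T : Set (EuclideanSpace ℝ (Fin 3)) := {z : EuclideanSpace ℝ (Fin 3) | z ∈ S ∧ z ≠ y ∧ dist z y < 13 / 10 * d}; ∃ A : EuclideanSpace ℝ (Fin 3) →ₗᵢ[ℝ] EuclideanSpace ℝ (Fin 3), (∃ e : ↥T ≃ ↥{p : EuclideanSpace ℝ (Fin 3) | p = !₂[(0 : ℝ), 0, 1] ∨ p = !₂[(0 : ℝ), 0, -1] ∨ ∃ k : Fin 5, ∃ σ : ℝ, (σ = 1 / 2 ∨ σ = -(1 / 2)) ∧ p = !₂[Real.sqrt 3 /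 2 * Real.cos (2 * Real.pi * (k : ℝ) / 5), Real.sqrt 3 / 2 * Real.sin (2 * Real.pi * (k : ℝ) / 5), σ]}, ∀ t : ↥T, dist (d⁻¹ • ((t : EuclideanSpace ℝ (Fin 3)) - y)) (A ((e t : ↥{p : EuclideanSpace ℝ (Fin 3) | p = !₂[(0 : ℝ), 0, 1] ∨ p = !₂[(0 : ℝ), 0, -1] ∨ ∃ k : Fin 5, ∃ σ : ℝ, (σ = 1 / 2 ∨ σ = -(1 / 2)) ∧ p = !₂[Real.sqrt 3 / 2 * Real.cos (2 * Real.pi * (k : ℝ) / 5), Real.sqrt 3 / 2 * Real.sin (2 * Real.pi * (k : ℝ) / 5), σ]}) : EuclideanSpace ℝ (Fin 3))) ≤ 1 / 20) ∧ dist (d⁻¹ • (γ (n + 1) - y)) (A (!₂[(0 : ℝ), 0, 1])) ≤ 1 / 20 ∧ dist (d⁻¹ • (γ (n - 1) - y)) (A (!₂[(0 : ℝ), 0, -1])) ≤ 1 / 20))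

/-- Statement of `stub_crossSectionGaussBonnet` (verbatim). -/
def Sig.stub_crossSectionGaussBonnet : Prop :=
  ∀ δ : ℝ, 0 < δ → ∀ S : Set (EuclideanSpace ℝ (Fin 3)), (∀ y ∈ S, ∀ z ∈ S, y ≠ z → δ ≤ dist y z) → (∃ R₁ : ℝ, ∀ p : EuclideanSpace ℝ (Fin 3), ∃ y ∈ S, dist y p ≤ R₁) → (∀ y ∈ S, (let d : ℝ := sInf ((fun z => dist z y) '' (S \ {y})); let T : Set (EuclideanSpace ℝ (Fin 3)) := {z : EuclideanSpace ℝ (Fin 3) | z ∈ S ∧ z ≠ y ∧ dist z y < 13 / 10 * d}; ∃ A : EuclideanSpace ℝ (Fin 3) →ₗᵢ[ℝ] EuclideanSpace ℝ (Fin 3), (∃ e : ↥T ≃ ↥Literature.Geometry.DiscreteGeometry.fccKissingPattern, ∀ t : ↥T, dist (d⁻¹ • ((t : EuclideanSpace ℝ (Fin 3)) - y)) (A ((e t : ↥Literature.Geometry.DiscreteGeometry.fccKissingPattern) : EuclideanSpace ℝ (Fin 3))) ≤ 1 / 20) ∨ (∃ e : ↥T ≃ ↥Literature.Geometry.DiscreteGeometry.hcpKissingPattern,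 ∀ t : ↥T, dist (d⁻¹ • ((t : EuclideanSpace ℝ (Fin 3)) - y)) (A ((e t : ↥Literature.Geometry.DiscreteGeometry.hcpKissingPattern) : EuclideanSpace ℝ (Fin 3))) ≤ 1 / 20) ∨ (∃ e : ↥T ≃ ↥{p : EuclideanSpace ℝ (Fin 3) | p = !₂[(0 : ℝ), 0, 1] ∨ p = !₂[(0 : ℝ), 0, -1] ∨ ∃ k : Fin 5, ∃ σ : ℝ, (σ = 1 / 2 ∨ σ = -(1 / 2)) ∧ p = !₂[Real.sqrt 3 / 2 * Real.cos (2 * Real.pi * (k : ℝ) / 5), Real.sqrt 3 / 2 * Real.sin (2 * Real.pi * (k : ℝ) / 5), σ]}, ∀ t : ↥T, dist (d⁻¹ • ((t : EuclideanSpace ℝ (Fin 3)) - y)) (A ((e t : ↥{p : EuclideanSpace ℝ (Fin 3) | p = !₂[(0 : ℝ), 0, 1] ∨ p = !₂[(0 : ℝ), 0, -1] ∨ ∃ k : Fin 5, ∃ σ : ℝ, (σ = 1 / 2 ∨ σ = -(1 / 2)) ∧ p = !₂[Real.sqrt 3 / 2 * Real.cos (2 * Real.pi * (k : ℝ) / 5),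 Real.sqrt 3 / 2 * Real.sin (2 * Real.pi * (k : ℝ) / 5), σ]}) : EuclideanSpace ℝ (Fin 3))) ≤ 1 / 20))) → ∀ Γ : Set (ℤ → EuclideanSpace ℝ (Fin 3)), (∀ y ∈ S, ¬ (let d : ℝ := sInf ((fun z => dist z y) '' (S \ {y})); let T : Set (EuclideanSpace ℝ (Fin 3)) := {z : EuclideanSpace ℝ (Fin 3) | z ∈ S ∧ z ≠ y ∧ dist z y < 13 / 10 * d}; ∃ A : EuclideanSpace ℝ (Fin 3) →ₗᵢ[ℝ] EuclideanSpace ℝ (Fin 3), (∃ e : ↥T ≃ ↥Literature.Geometry.DiscreteGeometry.fccKissingPattern, ∀ t : ↥T, dist (d⁻¹ • ((t : EuclideanSpace ℝ (Fin 3)) - y)) (A ((e t : ↥Literature.Geometry.DiscreteGeometry.fccKissingPattern) : EuclideanSpace ℝ (Fin 3))) ≤ 1 / 20) ∨ (∃ e : ↥T ≃ ↥Literature.Geometry.DiscreteGeometry.hcpKissingPattern, ∀ t : ↥T, dist (d⁻¹ • ((t : EuclideanSpace ℝ (Fin 3)) - y)) (A ((e t : ↥Literature.Geometry.DiscreteGeometry.hcpKissingPattern)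 : EuclideanSpace ℝ (Fin 3))) ≤ 1 / 20)) → ∃ γ ∈ Γ, ∃ n : ℤ, γ n = y) → (∀ γ ∈ Γ, ∀ n : ℤ, γ n ∈ S ∧ ¬ (let y : EuclideanSpace ℝ (Fin 3) := γ n; let d : ℝ := sInf ((fun z => dist z y) '' (S \ {y})); let T : Set (EuclideanSpace ℝ (Fin 3)) := {z : EuclideanSpace ℝ (Fin 3) | z ∈ S ∧ z ≠ y ∧ dist z y < 13 / 10 * d}; ∃ A : EuclideanSpace ℝ (Fin 3) →ₗᵢ[ℝ] EuclideanSpace ℝ (Fin 3), (∃ e : ↥T ≃ ↥Literature.Geometry.DiscreteGeometry.fccKissingPattern, ∀ t : ↥T, dist (d⁻¹ • ((t : EuclideanSpace ℝ (Fin 3)) - y)) (A ((e t : ↥Literature.Geometry.DiscreteGeometry.fccKissingPattern) : EuclideanSpace ℝ (Fin 3))) ≤ 1 / 20) ∨ (∃ e : ↥T ≃ ↥Literature.Geometry.DiscreteGeometry.hcpKissingPattern, ∀ t : ↥T, dist (d⁻¹ • ((t : EuclideanSpace ℝ (Fin 3)) - y)) (A ((e t : ↥Literature.Geometry.DiscreteGeometry.hcpKissingPattern)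 : EuclideanSpace ℝ (Fin 3))) ≤ 1 / 20))) → (∀ γ ∈ Γ, ∀ n : ℤ, (let y : EuclideanSpace ℝ (Fin 3) := γ n; let d : ℝ := sInf ((fun z => dist z y) '' (S \ {y})); let T : Set (EuclideanSpace ℝ (Fin 3)) := {z : EuclideanSpace ℝ (Fin 3) | z ∈ S ∧ z ≠ y ∧ dist z y < 13 / 10 * d}; ∃ A : EuclideanSpace ℝ (Fin 3) →ₗᵢ[ℝ] EuclideanSpace ℝ (Fin 3), (∃ e : ↥T ≃ ↥{p : EuclideanSpace ℝ (Fin 3) | p = !₂[(0 : ℝ), 0, 1] ∨ p = !₂[(0 : ℝ), 0, -1] ∨ ∃ k : Fin 5, ∃ σ : ℝ, (σ = 1 / 2 ∨ σ = -(1 / 2)) ∧ p = !₂[Real.sqrt 3 / 2 * Real.cos (2 * Real.pi * (k : ℝ) / 5), Real.sqrt 3 / 2 * Real.sin (2 * Real.pi * (k : ℝ) / 5), σ]}, ∀ t : ↥T, dist (d⁻¹ • ((t : EuclideanSpace ℝ (Fin 3)) - y)) (A ((e t : ↥{p : EuclideanSpace ℝ (Fin 3) | p = !₂[(0 : ℝ),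 0, 1] ∨ p = !₂[(0 : ℝ), 0, -1] ∨ ∃ k : Fin 5, ∃ σ : ℝ, (σ = 1 / 2 ∨ σ = -(1 / 2)) ∧ p = !₂[Real.sqrt 3 / 2 * Real.cos (2 * Real.pi * (k : ℝ) / 5), Real.sqrt 3 / 2 * Real.sin (2 * Real.pi * (k : ℝ) / 5), σ]}) : EuclideanSpace ℝ (Fin 3))) ≤ 1 / 20) ∧ dist (d⁻¹ • (γ (n + 1) - y)) (A (!₂[(0 : ℝ), 0, 1])) ≤ 1 / 20 ∧ dist (d⁻¹ • (γ (n - 1) - y)) (A (!₂[(0 : ℝ), 0, -1])) ≤ 1 / 20)) → ∃ C : ℝ, ∀ L : ℝ, 1 ≤ L → ∀ c : EuclideanSpace ℝ (Fin 3), (({y : EuclideanSpace ℝ (Fin 3) | y ∈ S ∧ dist y c ≤ L ∧ ¬ (let d : ℝ := sInf ((fun z => dist z y) '' (S \ {y})); let T : Set (EuclideanSpace ℝ (Fin 3)) := {z : EuclideanSpace ℝ (Fin 3) | z ∈ S ∧ z ≠ y ∧ dist z y < 13 / 10 * d}; ∃ A : EuclideanSpace ℝ (Fin 3) →ₗᵢ[ℝ]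 EuclideanSpace ℝ (Fin 3), (∃ e : ↥T ≃ ↥Literature.Geometry.DiscreteGeometry.fccKissingPattern, ∀ t : ↥T, dist (d⁻¹ • ((t : EuclideanSpace ℝ (Fin 3)) - y)) (A ((e t : ↥Literature.Geometry.DiscreteGeometry.fccKissingPattern) : EuclideanSpace ℝ (Fin 3))) ≤ 1 / 20) ∨ (∃ e : ↥T ≃ ↥Literature.Geometry.DiscreteGeometry.hcpKissingPattern, ∀ t : ↥T, dist (d⁻¹ • ((t : EuclideanSpace ℝ (Fin 3)) - y)) (A ((e t : ↥Literature.Geometry.DiscreteGeometry.hcpKissingPattern) : EuclideanSpace ℝ (Fin 3))) ≤ 1 / 20))} : Set (EuclideanSpace ℝ (Fin 3))).ncard : ℝ) ≤ C * L ^ 2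

/-! ## The composition: the crux BY NAME from the two stub statements (sorry-free) -/

/-- **Assembly**: stub 1 → stub 2 → the crux. Given admissible `δ, S` and `θ > 0`: `Γ` from
stub 1, `C` from stub 2, `L₀ := max 1 (C/θ)`; for `L ≥ L₀`, `#axis ∩ B̄_L(c) ≤ C·L² ≤ θ·L³`.
Hypotheses = the two stub statements by name (`Sig.stub_…`, verbatim the stub signatures);
concludes the route decl `DisclinationRation.FiveFoldRation` by name; no `sorry`. -/
theorem FiveFoldRation_of (h1 : Sig.stub_fanStructure) (h2 : Sig.stub_crossSectionGaussBonnet) :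
    Summit.AtomisticToContinuum.Crystallization.Theses.DisclinationRation.FiveFoldRation := by
  unfold Sig.stub_fanStructure at h1
  unfold Sig.stub_crossSectionGaussBonnet at h2
  unfold Summit.AtomisticToContinuum.Crystallization.Theses.DisclinationRation.FiveFoldRation
  intro GA GF δ hδ S hsep hdense hgood θ hθ
  obtain ⟨Γ, hc1, hc2, hc3⟩ := h1 δ hδ S hsep hdense hgood
  obtain ⟨C, hC⟩ := h2 δ hδ S hsep hdense hgood Γ hc1 hc2 hc3
  refine ⟨max 1 (C / θ), fun L hL c => ?_⟩
  have hL1 : (1 : ℝ) ≤ L := le_trans (le_max_left _ _) hL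
  have hL2 : C / θ ≤ L := le_trans (le_max_right _ _) hL
  have hCL : C ≤ θ * L := by
    have := (div_le_iff₀ hθ).mp hL2
    linarith [mul_comm L θ]
  have hL0 : (0 : ℝ) ≤ L := le_trans zero_le_one hL1
  calc (({y : EuclideanSpace ℝ (Fin 3) | y ∈ S ∧ dist y c ≤ L ∧ ¬ GF S y} : Set (EuclideanSpace ℝ (Fin 3))).ncard : ℝ)
        ≤ C * L ^ 2 := hC L hL1 c
    _ ≤ (θ * L) * L ^ 2 := mul_le_mul_of_nonneg_right hCL (by positivity)
    _ = θ * L ^ 3 := by ring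

/-- **The registered skeleton in one line**: the two declared stubs fed into `FiveFoldRation_of`
prove the crux by name, modulo exactly the two `sorry`s (hypothesis-free target of
`ledger skeleton check`). -/
theorem FiveFoldRation_proof : Summit.AtomisticToContinuum.Crystallization.Theses.DisclinationRation.FiveFoldRation :=
  FiveFoldRation_of stub_fanStructure stub_crossSectionGaussBonnet

end Summit.AtomisticToContinuum.Crystallization.Cruxes.FiveFoldRation.Birth
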